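import Summits.QuantumFields.YangMills.Theses.RenyiTelescope

/-!
# Route `RenyiTelescope` — the REPAIR of crux `CutoffRenyiL` is a genuine WEAKENING (helper for stmt-QuantumFields-27544)

On 2026-08-28 the ideator seat's self-audit predicted the crux `CutoffRenyiL` (stmt-QuantumFields-27137; exponent
`R₀(q−1)p⁴L^(3F.m)/L^(4J)`, Hölder orders `1 < q ≤ Q·L^(2J)`) FALSE as typed: in `d = 3` the lattice gauge coupling renormalises at FIRST
order in the spacing (G. D. Moore, Nucl. Phys. B523 (1998) 569, arXiv:hep-lat/9709053, eq. (gaugerenorm) p.8 and the SU(2) numbers p.16),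
while the tower `β_K = L^K/γ` is naive, so consecutive interior-conditioned unit laws differ by a covariance drift `δ_J ≍ γL^(−J)` and their
order-`q` Rényi divergence is `≍ q·γ²·L^(3F.m)·L^(−2J)`, not `L^(−4J)`.  The repaired crux `CutoffRenyiLR` (stmt-QuantumFields-27544) has exponent
`R₀(q−1)p⁴L^(3F.m)(γ²/L^(2J) + 1/L^(4J))` and orders `1 < q ≤ Q·L^J`.

THIS FILE (the "old ↔ new" certificate asked for by the critic, NOTE #84): `cutoffRenyiLR_of_cutoffRenyiL : CutoffRenyiL → CutoffRenyiLR` — the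
repair only WEAKENS the statement (smaller order range since `L^J ≤ L^(2J)`, larger exponent since `γ²/L^(2J) ≥ 0`; a possibly negative `R₀` is
replaced by `max R₀ 0`).  The converse is NOT claimed (and is believed false: the new statement tolerates the first-order drift, the old does not).

WHAT THIS IS NOT: neither crux is proved; nothing here bears on the Yang–Mills mass gap; the rung R3 (`YM3TorusSU2`) is NOT proved.
-/

noncomputable section

open MeasureTheory
open Literature.MathematicalPhysics.QuantumFieldTheory.Balaban1983to89
open Literature.MathematicalPhysics.QuantumFieldTheory.Balaban1983to89.T3ContinuumYM3Torus
open Literature.MathematicalPhysics.QuantumFieldTheory.Balaban1983to89.T3UnitScaleTilt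
open Literature.MathematicalPhysics.QuantumFieldTheory.Balaban1983to89.T3UnitLawDensityEML
open Literature.MathematicalPhysics.QuantumFieldTheory.Balaban1983to89.T3InteriorExcision

namespace Summit.QuantumFields.YangMills.Theorems.RenyiTelescope

/-- Exponent comparison: for `R₀ ≤ R₀'`, `0 ≤ R₀'`, `0 ≤ W`, `0 < D` and `0 ≤ G`,
`R₀·W/D ≤ R₀'·W·(G + 1/D)`. -/
theorem exponent_weaken {R₀ R₀' W D G : ℝ} (hR : R₀ ≤ R₀') (hR' : 0 ≤ R₀') (hW : 0 ≤ W) (hD : 0 < D) (hG : 0 ≤ G) :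
    R₀ * W / D ≤ R₀' * W * (G + 1 / D) := by
  have h1 : R₀ * W / D ≤ R₀' * W / D := by
    apply div_le_div_of_nonneg_right _ hD.le
    exact mul_le_mul_of_nonneg_right hR hW
  have h2 : R₀' * W / D = R₀' * W * (1 / D) := by ring
  have h3 : R₀' * W * (1 / D) ≤ R₀' * W * (G + 1 / D) :=
    mul_le_mul_of_nonneg_left (by linarith) (mul_nonneg hR' hW)
  linarith [h1, h2, h3]

/-- THE CERTIFICATE: the repaired crux is implied by the original one (the repair is a weakening). -/
theorem cutoffRenyiLR_of_cutoffRenyiL :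
    Summit.QuantumFields.YangMills.Theses.RenyiTelescope.CutoffRenyiL →
      Summit.QuantumFields.YangMills.Theses.RenyiTelescope.CutoffRenyiLR := by
  intro hOld L
  obtain ⟨c, b₁, p₁, hc0, hc1, h1⟩ := hOld L
  refine ⟨c, b₁, p₁, hc0, hc1, fun b₀ p₀ hb hp hb0 hp2 => ?_⟩
  obtain ⟨γ₁, Q, R₀, hγ₁0, hγ₁1, hQ, h2⟩ := h1 b₀ p₀ hb hp hb0 hp2
  refine ⟨γ₁, Q, max R₀ 0, hγ₁0, hγ₁1, hQ, fun F γ hFL hγ0 hγ1 J q hJ hq1 hqQ A hA => ?_⟩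
  have hL1 : (1 : ℝ) ≤ (L : ℝ) := by
    have := F.hL.2; rw [hFL] at this; exact_mod_cast this.le
  have hL0 : (0 : ℝ) < (L : ℝ) := by linarith
  have hqQ' : q ≤ Q * (L : ℝ) ^ (2 * J) := by
    refine le_trans hqQ (mul_le_mul_of_nonneg_left ?_ hQ.le)
    exact pow_le_pow_right₀ hL1 (by omega)
  have hold := h2 F γ hFL hγ0 hγ1 J q hJ hq1 hqQ' A hA
  refine le_trans hold ?_
  refine mul_le_mul_of_nonneg_right (mul_le_mul_of_nonneg_right (Real.exp_le_exp.mpr ?_)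
    (Real.rpow_nonneg measureReal_nonneg _)) measureReal_nonneg
  have hW : 0 ≤ (q - 1) * (B10.pFun b₀ p₀ (Real.sqrt γ)) ^ 4 * (L : ℝ) ^ (3 * F.m) := by
    have : 0 ≤ (B10.pFun b₀ p₀ (Real.sqrt γ)) ^ 4 := by positivity
    have : 0 ≤ (L : ℝ) ^ (3 * F.m) := by positivity
    have : 0 ≤ q - 1 := by linarith
    positivity
  have hD : 0 < (L : ℝ) ^ (4 * J) := by positivity
  have hG : 0 ≤ γ ^ 2 / (L : ℝ) ^ (2 * J) := by positivity
  have key := exponent_weaken (le_max_left R₀ 0) (le_max_right R₀ 0) hW hD hG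
  calc R₀ * (q - 1) * (B10.pFun b₀ p₀ (Real.sqrt γ)) ^ 4 * (L : ℝ) ^ (3 * F.m) / (L : ℝ) ^ (4 * J)
      = R₀ * ((q - 1) * (B10.pFun b₀ p₀ (Real.sqrt γ)) ^ 4 * (L : ℝ) ^ (3 * F.m)) / (L : ℝ) ^ (4 * J) := by ring
    _ ≤ max R₀ 0 * ((q - 1) * (B10.pFun b₀ p₀ (Real.sqrt γ)) ^ 4 * (L : ℝ) ^ (3 * F.m)) *
          (γ ^ 2 / (L : ℝ) ^ (2 * J) + 1 / (L : ℝ) ^ (4 * J)) := key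
    _ = max R₀ 0 * (q - 1) * (B10.pFun b₀ p₀ (Real.sqrt γ)) ^ 4 * (L : ℝ) ^ (3 * F.m) *
          (γ ^ 2 / (L : ℝ) ^ (2 * J) + 1 / (L : ℝ) ^ (4 * J)) := by ring

end Summit.QuantumFields.YangMills.Theorems.RenyiTelescope

end
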